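import Summits.SmoothPoincare4.SmoothPoincare4.Theses.SpectralDevelopingMap
import HarnessLib.Audit

/-!
# Birth skeleton (BC3) of the crux `SpectralDevelopingMap.GroundStateMapsUnfold`

Crux item `stmt-SmoothPoincare4-7412` (decl
`Summit.SmoothPoincare4.SmoothPoincare4.Theses.SpectralDevelopingMap.GroundStateMapsUnfold`, crux rank 2 of
route `route-SmoothPoincare4-SpectralDevelopingMap`; re-audit bin REPAIRABLE). Tree path
`Cruxes/GroundStateMapsUnfold/Lines/birth.lean`; registrar `planner-skel-stmt-SmoothPoincare4-7412-0`, 2026-08-17.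
The route (opened 2026-08-15) predates the Lean birth certificate; this file supplies BC3 retroactively. It types
the route's OWN foreseen layer-1 cut of U (route header, TWO-LAYER PLAN: "GroundStateMapsUnfold ⇐
NoCriticalZeroOfGroundStates … → FoldIsNodalCriticalPoint → U"), sharpened by the structure of the one proved case
(support `CorotationalNoFold`: Courant/Sturm nodal count of a height function + a sign argument at a fold).

THE CRUX (U). `(M⁴, g)` closed, `Φ : M → S⁴ ⊂ ℝ⁵` smooth and (equal to) a homotopy equivalence, harmonic-map
equation `Δ_g Φᵢ = −E Φᵢ` with `E = Σᵢ |dΦᵢ|²_g`, ground-state (Rayleigh) clause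
`∀ u smooth, ∫ E u = 0 → ∫ E u² ≤ ∫ |du|²` ⟹ `Φ` is a `C^∞` local diffeomorphism.

THE CUT (three named stubs; "height function" = `f_a := ⟪a, Φ⟫`, `a ∈ ℝ⁵`):

* `stub_heightFunctionsNodallySimple` (A — weighted COURANT, known-in-kind, Lean size L/XL): on a CONNECTED closed
  `M`, for a ground-state map every height function `f_a` has connected positivity set and connected negativity set
  (≤ 2 nodal domains). Mechanism: `f_a` solves `Δ f_a = −E f_a` and saturates the Rayleigh clause, so it is a first
  weighted eigenfunction; two positive nodal domains `P₁, P₂` give a truncated competitor `c₁ f_a 1_{P₁} + c₂ f_a 1_{P₂}`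
  with `∫ E w = 0` and zero Rayleigh deficit, hence a weak solution of `Δ w = −E w` vanishing on the open set
  `{f_a < 0}` — unique continuation (Aronszajn) kills it (Courant–Hilbert VI §6; Cheng1976 §1; KarpukhinStern2024 §2
  use exactly this weighted form). Needs Green on nodal domains, `W^{1,2}` density, Euler–Lagrange, elliptic
  regularity, UCP — none in Mathlib: genuine work, not bookkeeping. `ConnectedSpace M` is essential (on `S⁴ ⊔ S⁴`
  the statement is false) and is supplied in the composition from the homotopy equivalence `M ≃ₕ S⁴`.
* `stub_noCriticalNodalZero` (B — THE BET of the line, open, size XL): a ground-state homotopy equivalence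
  `Φ : M → S⁴` all of whose height functions are nodally simple has NO CRITICAL NODAL POINT: `a ≠ 0`, `f_a(x) = 0`
  ⟹ `d f_a(x) ≠ 0`. Evidence: in the corotational class this is exactly the proved mechanism of `CorotationalNoFold`
  (at a fold `sign α'' = sign sin 2α`, forcing a third zero of the height function `cos α`); the folded degree-one
  harmonic self-maps of `S⁴` (BizonChmaj1997, nodal number ≥ 3) violate nodal simplicity, consistently. Why it might
  fail: a `(2,2)`-Morse critical zero of `f_a` is locally compatible with two nodal domains, so B must use the
  harmonic-map equation and the degree, not nodal topology alone (route header, why-it-might-fail of U).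
  B keeps every hypothesis of U (so a counterexample to B is a counterexample to U) and ADDS nodal simplicity.
* `stub_unfoldOfNoCriticalNodalZero` (C — linear algebra + manifold inverse function theorem, known, Lean size M):
  a smooth `Φ : M⁴ → S⁴` with no critical nodal point is a local diffeomorphism (`a ↦ d⟪a,Φ⟫ₓ` injective on
  `Φ(x)^⊥` ⟺ `dΦₓ` has rank 4; then `isLocalDiffeomorphAt_of_mfderiv`). It is the globalised `⇐` direction of the
  route's support item `FoldIsNodalCriticalPoint` (stmt-SmoothPoincare4-7417), stated with the same spelling so that a
  proof of 7417 discharges it in a few lines.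

COMPOSITION. `GroundStateMapsUnfold_of : Stmt.stub_A → Stmt.stub_B → Stmt.stub_C → GroundStateMapsUnfold` (real
proof, no sorry; the hypotheses are the named statement copies `Stmt.stub_*`, admissible BY NAME for the A12 audit)
derives `ConnectedSpace M` from `M ≃ₕ S⁴` (`simplyConnectedSpace_sphere_four_holds`, `HomotopyEquiv.simplyConnectedSpace`,
simply connected ⇒ path connected ⇒ connected), feeds A's nodal simplicity into B and B's pointwise conclusion into C;
`GroundStateMapsUnfold_proof : GroundStateMapsUnfold := GroundStateMapsUnfold_of stub_A stub_B stub_C` compiler-checks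
that the registered stubs restate the `Stmt` copies verbatim. Hardest stub: B.

HONEST NOTE ON THE SEAM. The cut is an interpolant cut through the property NS = "all height functions nodally
simple": A = (hypotheses of U ⇒ NS) is a theorem-in-kind (weighted Courant), C is the standard fold/nodal bridge, and
all that is conjectural in U is isolated in B, which is U's nodal form WEAKENED by the extra hypothesis NS — the one
structure the proved corotational case actually uses. No stub is cheaply the crux or the summit: BC3 probes
`stub → GroundStateMapsUnfold` and `stub → SmoothPoincare4` by `first | exact? | simpa [·] | (unfold ·; simpa) | aesop`
fail 6/6 (folder `bc/probe_*.lean`, raw outputs in NOTES.md / `Lines/birth.md`).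

Disproof used: none exists for this crux (`ledger crux ls stmt-SmoothPoincare4-7412`: no workfiles, no crux ideas at
registration); negatives index `ledger negatives --problem SmoothPoincare4`: 0 refuted statements (2026-08-17), so no
stub is an instance of a refuted statement. No new route, no restatement of U: binders of A/B are U's own, verbatim.
-/

namespace Summit.SmoothPoincare4.SmoothPoincare4.Cruxes.GroundStateMapsUnfold.Birth

open scoped BigOperators Topology Manifold MeasureTheory InnerProductSpace ContinuousMap ContDiff
open MeasureTheory
open Summit.SmoothPoincare4.SmoothPoincare4.Theses.SpectralDevelopingMap (GroundStateMapsUnfold)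

set_option linter.dupNamespace false
set_option linter.unusedVariables false

/-! ## The three stub statements as NAMED Props (hypotheses of `GroundStateMapsUnfold_of`, admissible by name) -/

/-- Statement of STUB A (weighted Courant nodal theorem for the height functions of a ground-state map on a
connected closed 4-manifold): `{f_a > 0}` and `{f_a < 0}` are (pre)connected for every `a ∈ ℝ⁵`. -/
def Stmt.stub_heightFunctionsNodallySimple : Prop :=
  ∀ (M : Type) [TopologicalSpace M] [T2Space M] [SecondCountableTopology M]
    [ChartedSpace (EuclideanSpace ℝ (Fin 4)) M] [IsManifold (𝓡 4) ∞ M] [CompactSpace M] [T3Space M]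
    [MeasurableSpace M] [BorelSpace M] [ConnectedSpace M]
    (g : Bundle.ContMDiffRiemannianMetric (𝓡 4) ∞ (EuclideanSpace ℝ (Fin 4)) (TangentSpace (𝓡 4) : M → Type _))
    (_ : (Literature.Geometry.Lorentzian.PseudoRiemannianMetric.ofRiemannian g).HasLeviCivita)
    (Φ : M → Metric.sphere (0 : EuclideanSpace ℝ (Fin 5)) 1) (E : M → ℝ),
    ContMDiff (𝓡 4) (𝓡 4) ∞ Φ →
    (∀ x, E x = ∑ i : Fin 5, (Literature.Geometry.Lorentzian.PseudoRiemannianMetric.ofRiemannian g).innerDual x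
      (mvfderiv (𝓡 4) (fun y => (Φ y : EuclideanSpace ℝ (Fin 5)) i) x).toLinearMap
      (mvfderiv (𝓡 4) (fun y => (Φ y : EuclideanSpace ℝ (Fin 5)) i) x).toLinearMap) →
    (∀ (i : Fin 5) (x : M), (Literature.Geometry.Lorentzian.PseudoRiemannianMetric.ofRiemannian g).dalembertian
      (fun y => (Φ y : EuclideanSpace ℝ (Fin 5)) i) x = -(E x) * (Φ x : EuclideanSpace ℝ (Fin 5)) i) →
    (∀ u : M → ℝ, ContMDiff (𝓡 4) 𝓘(ℝ, ℝ) ∞ u →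
      ∫ x, E x * u x ∂(Literature.Geometry.Lorentzian.riemannianMeasure g) = 0 →
      ∫ x, E x * u x ^ 2 ∂(Literature.Geometry.Lorentzian.riemannianMeasure g) ≤
        ∫ x, (Literature.Geometry.Lorentzian.PseudoRiemannianMetric.ofRiemannian g).innerDual x
          (mvfderiv (𝓡 4) u x).toLinearMap (mvfderiv (𝓡 4) u x).toLinearMap
          ∂(Literature.Geometry.Lorentzian.riemannianMeasure g)) →
    ∀ a : EuclideanSpace ℝ (Fin 5),
      IsPreconnected {x : M | 0 < inner ℝ a (Φ x : EuclideanSpace ℝ (Fin 5))} ∧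
      IsPreconnected {x : M | inner ℝ a (Φ x : EuclideanSpace ℝ (Fin 5)) < 0}

/-- Statement of STUB B (the bet): a ground-state homotopy equivalence `M → S⁴` with nodally simple height functions
has no critical nodal point. -/
def Stmt.stub_noCriticalNodalZero : Prop :=
  ∀ (M : Type) [TopologicalSpace M] [T2Space M] [SecondCountableTopology M]
    [ChartedSpace (EuclideanSpace ℝ (Fin 4)) M] [IsManifold (𝓡 4) ∞ M] [CompactSpace M] [T3Space M]
    [MeasurableSpace M] [BorelSpace M]
    (g : Bundle.ContMDiffRiemannianMetric (𝓡 4) ∞ (EuclideanSpace ℝ (Fin 4)) (TangentSpace (𝓡 4) : M → Type _))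
    (_ : (Literature.Geometry.Lorentzian.PseudoRiemannianMetric.ofRiemannian g).HasLeviCivita)
    (Φ : M → Metric.sphere (0 : EuclideanSpace ℝ (Fin 5)) 1) (E : M → ℝ),
    ContMDiff (𝓡 4) (𝓡 4) ∞ Φ →
    (∃ e : M ≃ₕ (Metric.sphere (0 : EuclideanSpace ℝ (Fin 5)) 1),
      (e : M → Metric.sphere (0 : EuclideanSpace ℝ (Fin 5)) 1) = Φ) →
    (∀ x, E x = ∑ i : Fin 5, (Literature.Geometry.Lorentzian.PseudoRiemannianMetric.ofRiemannian g).innerDual x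
      (mvfderiv (𝓡 4) (fun y => (Φ y : EuclideanSpace ℝ (Fin 5)) i) x).toLinearMap
      (mvfderiv (𝓡 4) (fun y => (Φ y : EuclideanSpace ℝ (Fin 5)) i) x).toLinearMap) →
    (∀ (i : Fin 5) (x : M), (Literature.Geometry.Lorentzian.PseudoRiemannianMetric.ofRiemannian g).dalembertian
      (fun y => (Φ y : EuclideanSpace ℝ (Fin 5)) i) x = -(E x) * (Φ x : EuclideanSpace ℝ (Fin 5)) i) →
    (∀ u : M → ℝ, ContMDiff (𝓡 4) 𝓘(ℝ, ℝ) ∞ u →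
      ∫ x, E x * u x ∂(Literature.Geometry.Lorentzian.riemannianMeasure g) = 0 →
      ∫ x, E x * u x ^ 2 ∂(Literature.Geometry.Lorentzian.riemannianMeasure g) ≤
        ∫ x, (Literature.Geometry.Lorentzian.PseudoRiemannianMetric.ofRiemannian g).innerDual x
          (mvfderiv (𝓡 4) u x).toLinearMap (mvfderiv (𝓡 4) u x).toLinearMap
          ∂(Literature.Geometry.Lorentzian.riemannianMeasure g)) →
    (∀ a : EuclideanSpace ℝ (Fin 5),
      IsPreconnected {x : M | 0 < inner ℝ a (Φ x : EuclideanSpace ℝ (Fin 5))} ∧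
      IsPreconnected {x : M | inner ℝ a (Φ x : EuclideanSpace ℝ (Fin 5)) < 0}) →
    ∀ (x : M) (a : EuclideanSpace ℝ (Fin 5)), a ≠ 0 → inner ℝ a (Φ x : EuclideanSpace ℝ (Fin 5)) = 0 →
      mvfderiv (𝓡 4) (fun y => inner ℝ a (Φ y : EuclideanSpace ℝ (Fin 5))) x ≠ 0

/-- Statement of STUB C (fold = critical nodal point, globalised `⇐` direction): a smooth `Φ : M⁴ → S⁴` with no
critical nodal point is a `C^∞` local diffeomorphism. -/
def Stmt.stub_unfoldOfNoCriticalNodalZero : Prop :=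
  ∀ (M : Type) [TopologicalSpace M] [T2Space M] [SecondCountableTopology M]
    [ChartedSpace (EuclideanSpace ℝ (Fin 4)) M] [IsManifold (𝓡 4) ∞ M]
    (Φ : M → Metric.sphere (0 : EuclideanSpace ℝ (Fin 5)) 1),
    ContMDiff (𝓡 4) (𝓡 4) ∞ Φ →
    (∀ (x : M) (a : EuclideanSpace ℝ (Fin 5)), a ≠ 0 → inner ℝ a (Φ x : EuclideanSpace ℝ (Fin 5)) = 0 →
      mvfderiv (𝓡 4) (fun y => inner ℝ a (Φ y : EuclideanSpace ℝ (Fin 5))) x ≠ 0) →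
    IsLocalDiffeomorph (𝓡 4) (𝓡 4) ∞ Φ

/-! ## Registered stubs (the ONLY sorries of this file; each restates its `Stmt` copy verbatim) -/

/-- STUB A (weighted Courant; known-in-kind, Lean size L/XL): height functions of a ground-state map on a connected
closed Riemannian 4-manifold have connected positivity and negativity sets. Courant–Hilbert VI §6, Cheng1976 §1,
KarpukhinStern2024 §2 (weighted first eigenfunctions), Aronszajn unique continuation. -/
theorem stub_heightFunctionsNodallySimple :
    ∀ (M : Type) [TopologicalSpace M] [T2Space M] [SecondCountableTopology M]
    [ChartedSpace (EuclideanSpace ℝ (Fin 4)) M] [IsManifold (𝓡 4) ∞ M] [CompactSpace M] [T3Space M]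
    [MeasurableSpace M] [BorelSpace M] [ConnectedSpace M]
    (g : Bundle.ContMDiffRiemannianMetric (𝓡 4) ∞ (EuclideanSpace ℝ (Fin 4)) (TangentSpace (𝓡 4) : M → Type _))
    (_ : (Literature.Geometry.Lorentzian.PseudoRiemannianMetric.ofRiemannian g).HasLeviCivita)
    (Φ : M → Metric.sphere (0 : EuclideanSpace ℝ (Fin 5)) 1) (E : M → ℝ),
    ContMDiff (𝓡 4) (𝓡 4) ∞ Φ →
    (∀ x, E x = ∑ i : Fin 5, (Literature.Geometry.Lorentzian.PseudoRiemannianMetric.ofRiemannian g).innerDual x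
      (mvfderiv (𝓡 4) (fun y => (Φ y : EuclideanSpace ℝ (Fin 5)) i) x).toLinearMap
      (mvfderiv (𝓡 4) (fun y => (Φ y : EuclideanSpace ℝ (Fin 5)) i) x).toLinearMap) →
    (∀ (i : Fin 5) (x : M), (Literature.Geometry.Lorentzian.PseudoRiemannianMetric.ofRiemannian g).dalembertian
      (fun y => (Φ y : EuclideanSpace ℝ (Fin 5)) i) x = -(E x) * (Φ x : EuclideanSpace ℝ (Fin 5)) i) →
    (∀ u : M → ℝ, ContMDiff (𝓡 4) 𝓘(ℝ, ℝ) ∞ u →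
      ∫ x, E x * u x ∂(Literature.Geometry.Lorentzian.riemannianMeasure g) = 0 →
      ∫ x, E x * u x ^ 2 ∂(Literature.Geometry.Lorentzian.riemannianMeasure g) ≤
        ∫ x, (Literature.Geometry.Lorentzian.PseudoRiemannianMetric.ofRiemannian g).innerDual x
          (mvfderiv (𝓡 4) u x).toLinearMap (mvfderiv (𝓡 4) u x).toLinearMap
          ∂(Literature.Geometry.Lorentzian.riemannianMeasure g)) →
    ∀ a : EuclideanSpace ℝ (Fin 5),
      IsPreconnected {x : M | 0 < inner ℝ a (Φ x : EuclideanSpace ℝ (Fin 5))} ∧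
      IsPreconnected {x : M | inner ℝ a (Φ x : EuclideanSpace ℝ (Fin 5)) < 0} := by
  sorry

/-- STUB B (the bet; open, size XL): a ground-state homotopy equivalence `(M⁴, g) → S⁴` whose height functions are
all nodally simple has no critical nodal point (`a ≠ 0`, `⟪a, Φ x⟫ = 0` ⟹ `d⟪a, Φ⟫ₓ ≠ 0`). Proved mechanism in the
corotational class (`CorotationalNoFold`); BizonChmaj1997's folded maps violate the nodal hypothesis. -/
theorem stub_noCriticalNodalZero :
    ∀ (M : Type) [TopologicalSpace M] [T2Space M] [SecondCountableTopology M]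
    [ChartedSpace (EuclideanSpace ℝ (Fin 4)) M] [IsManifold (𝓡 4) ∞ M] [CompactSpace M] [T3Space M]
    [MeasurableSpace M] [BorelSpace M]
    (g : Bundle.ContMDiffRiemannianMetric (𝓡 4) ∞ (EuclideanSpace ℝ (Fin 4)) (TangentSpace (𝓡 4) : M → Type _))
    (_ : (Literature.Geometry.Lorentzian.PseudoRiemannianMetric.ofRiemannian g).HasLeviCivita)
    (Φ : M → Metric.sphere (0 : EuclideanSpace ℝ (Fin 5)) 1) (E : M → ℝ),
    ContMDiff (𝓡 4) (𝓡 4) ∞ Φ →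
    (∃ e : M ≃ₕ (Metric.sphere (0 : EuclideanSpace ℝ (Fin 5)) 1),
      (e : M → Metric.sphere (0 : EuclideanSpace ℝ (Fin 5)) 1) = Φ) →
    (∀ x, E x = ∑ i : Fin 5, (Literature.Geometry.Lorentzian.PseudoRiemannianMetric.ofRiemannian g).innerDual x
      (mvfderiv (𝓡 4) (fun y => (Φ y : EuclideanSpace ℝ (Fin 5)) i) x).toLinearMap
      (mvfderiv (𝓡 4) (fun y => (Φ y : EuclideanSpace ℝ (Fin 5)) i) x).toLinearMap) →
    (∀ (i : Fin 5) (x : M), (Literature.Geometry.Lorentzian.PseudoRiemannianMetric.ofRiemannian g).dalembertian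
      (fun y => (Φ y : EuclideanSpace ℝ (Fin 5)) i) x = -(E x) * (Φ x : EuclideanSpace ℝ (Fin 5)) i) →
    (∀ u : M → ℝ, ContMDiff (𝓡 4) 𝓘(ℝ, ℝ) ∞ u →
      ∫ x, E x * u x ∂(Literature.Geometry.Lorentzian.riemannianMeasure g) = 0 →
      ∫ x, E x * u x ^ 2 ∂(Literature.Geometry.Lorentzian.riemannianMeasure g) ≤
        ∫ x, (Literature.Geometry.Lorentzian.PseudoRiemannianMetric.ofRiemannian g).innerDual x
          (mvfderiv (𝓡 4) u x).toLinearMap (mvfderiv (𝓡 4) u x).toLinearMap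
          ∂(Literature.Geometry.Lorentzian.riemannianMeasure g)) →
    (∀ a : EuclideanSpace ℝ (Fin 5),
      IsPreconnected {x : M | 0 < inner ℝ a (Φ x : EuclideanSpace ℝ (Fin 5))} ∧
      IsPreconnected {x : M | inner ℝ a (Φ x : EuclideanSpace ℝ (Fin 5)) < 0}) →
    ∀ (x : M) (a : EuclideanSpace ℝ (Fin 5)), a ≠ 0 → inner ℝ a (Φ x : EuclideanSpace ℝ (Fin 5)) = 0 →
      mvfderiv (𝓡 4) (fun y => inner ℝ a (Φ y : EuclideanSpace ℝ (Fin 5))) x ≠ 0 := by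
  sorry

/-- STUB C (known; linear algebra on `T_{Φ x} S⁴ = (Φ x)^⊥` + the manifold inverse function theorem, Lean size M):
a smooth `Φ : M⁴ → S⁴` with no critical nodal point is a local diffeomorphism (globalised `⇐` of support item
`FoldIsNodalCriticalPoint`, stmt-SmoothPoincare4-7417; LeeSmoothManifolds2013 Thm 4.5). -/
theorem stub_unfoldOfNoCriticalNodalZero :
    ∀ (M : Type) [TopologicalSpace M] [T2Space M] [SecondCountableTopology M]
    [ChartedSpace (EuclideanSpace ℝ (Fin 4)) M] [IsManifold (𝓡 4) ∞ M]
    (Φ : M → Metric.sphere (0 : EuclideanSpace ℝ (Fin 5)) 1),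
    ContMDiff (𝓡 4) (𝓡 4) ∞ Φ →
    (∀ (x : M) (a : EuclideanSpace ℝ (Fin 5)), a ≠ 0 → inner ℝ a (Φ x : EuclideanSpace ℝ (Fin 5)) = 0 →
      mvfderiv (𝓡 4) (fun y => inner ℝ a (Φ y : EuclideanSpace ℝ (Fin 5))) x ≠ 0) →
    IsLocalDiffeomorph (𝓡 4) (𝓡 4) ∞ Φ := by
  sorry

/-! ## The composition (kernel-checked, sorry-free) -/

/-- COMPOSITION (real proof, no sorry): the three stub statements imply the crux BY NAME. `M` is connected because it
is homotopy equivalent to the simply connected `S⁴`; A gives nodal simplicity of all height functions, B turns it into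
the absence of critical nodal points, C unfolds the map. -/
theorem GroundStateMapsUnfold_of :
    Stmt.stub_heightFunctionsNodallySimple → Stmt.stub_noCriticalNodalZero →
    Stmt.stub_unfoldOfNoCriticalNodalZero → GroundStateMapsUnfold := by
  intro hA hB hC M _ _ _ _ _ _ _ _ _ g hg Φ E hΦ he hE hΔ hRay
  -- point-set topology: a homotopy 4-sphere is connected
  obtain ⟨e, heΦ⟩ := he
  haveI : SimplyConnectedSpace (Metric.sphere (0 : EuclideanSpace ℝ (Fin 5)) 1) :=
    Literature.Topology.FourManifolds.simplyConnectedSpace_sphere_four_holds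
  haveI : SimplyConnectedSpace M := e.simplyConnectedSpace
  haveI : ConnectedSpace M := inferInstance
  -- A: every height function is nodally simple
  have hNS : ∀ a : EuclideanSpace ℝ (Fin 5),
      IsPreconnected {x : M | 0 < inner ℝ a (Φ x : EuclideanSpace ℝ (Fin 5))} ∧
      IsPreconnected {x : M | inner ℝ a (Φ x : EuclideanSpace ℝ (Fin 5)) < 0} :=
    hA M g hg Φ E hΦ hE hΔ hRay
  -- B: hence no height function has a critical zero
  have hcrit : ∀ (x : M) (a : EuclideanSpace ℝ (Fin 5)), a ≠ 0 →
      inner ℝ a (Φ x : EuclideanSpace ℝ (Fin 5)) = 0 →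
      mvfderiv (𝓡 4) (fun y => inner ℝ a (Φ y : EuclideanSpace ℝ (Fin 5))) x ≠ 0 :=
    hB M g hg Φ E hΦ ⟨e, heΦ⟩ hE hΔ hRay hNS
  -- C: a fold would be a critical nodal point
  exact hC M Φ hΦ hcrit

/-- THE SKELETON: the crux modulo exactly the three registered stubs (compiler-checks that the `Stmt` copies and the
stub statements agree; its only non-whitelisted axiom is the stubs' `sorryAx`). -/
theorem GroundStateMapsUnfold_proof : GroundStateMapsUnfold :=
  GroundStateMapsUnfold_of stub_heightFunctionsNodallySimple stub_noCriticalNodalZero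
    stub_unfoldOfNoCriticalNodalZero

end Summit.SmoothPoincare4.SmoothPoincare4.Cruxes.GroundStateMapsUnfold.Birth
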